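import Literature.Computability.QuantumComplexity.Factoring
import Literature.Computability.Complexity.BrickAlgebra
import Literature.Computability.Complexity.StackBricksArith
import Literature.Computability.Complexity.StringEquality
import Literature.Computability.Complexity.LengthCompare
import HarnessLib

/-!
# Factoring is in `NP` (the easy half of pqc.S26)

Family `PQC`, companion of `Factoring.lean` (`Literature.Computability.QuantumComplexity.FACT`, the bounded-divisor decision
version `{⟨N, k⟩ : ∃ d, 1 < d ≤ k ∧ d ∣ N}` of integer factorisation, pairs of canonical binary
numerals paired by `boolPair`). We prove

* `FACT_mem_NP : FACT ∈ NP` — the certificate of `⟨N, k⟩` is (the numeral of) a divisor `d`;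
  the verifier checks that the instance is a well-formed pair of canonical numerals, that
  `1 < d ≤ k` and that `N mod d = 0`.

The verifier is assembled in the tree's algebra of `FP` string functions (`BrickAlgebra.lean`:
projections `fstF`/`sndF`, `fanoutFn`, one-bit conditions `andFn`/`notFn`; arithmetic bricks
`ltFn`, `remFn`, `isNilFn`, `norm` of `StackBricks*.lean`; the string-equality test `eqPairFn`
of `StringEquality.lean`), so that its polynomial running time on Mathlib's `Turing.FinTM2` is
inherited from the bricks (`mem_P_of_mem_FP`). The `coNP` half (Pratt certificates) is in the
sibling files `PrattCertificates.lean` / `PrattMachine.lean` / `FactoringProofs.lean`.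

## References

* S. Arora, B. Barak, *Computational Complexity: A Modern Approach*, CUP 2009, §2.1,
  Example 2.3 (p. 40: "Factoring … The certificate is the factor p"), Def. 2.1.
* V. Pratt, *Every prime has a succinct certificate*, SIAM J. Comput. 4 (1975) 214–220 (the
  `coNP` half; not used in this file).
-/

namespace Literature.Computability.QuantumComplexity

open _root_.Computability Complexity Complexity.Classes Complexity.Nondeterministic Complexity.Brick

/-! ### Valid instances -/

/-- The re-normalised instance: `x ↦ ⟨norm x.1, norm x.2⟩`. A string `x` is the code of a pair of
numbers iff it is fixed by this map (`eq_renorm_iff`). [folklore] -/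
noncomputable def renormFn : List Bool → List Bool :=
  fanoutFn (norm ∘ fstF) (norm ∘ sndF)

/-- `renormFn ∈ FP`. [folklore] -/
theorem renormFn_mem_FP : renormFn ∈ FP :=
  fanoutFn_mem_FP (comp_mem_FP norm_mem_FP fstF_mem_FP) (comp_mem_FP norm_mem_FP sndF_mem_FP)

/-- Value of `renormFn`. [folklore] -/
theorem renormFn_apply (x : List Bool) :
    renormFn x = boolPair (encodeNat (bitsToNat (fstF x))) (encodeNat (bitsToNat (sndF x))) := by
  simp [renormFn, norm_eq_encodeNat]

/-- The code of the pair `(N, k)`. [folklore] -/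
theorem pairBool_encode (N k : ℕ) :
    (encodingNatBool.pairBool encodingNatBool).encode (N, k) = boolPair (encodeNat N) (encodeNat k) :=
  rfl

/-- **A string codes a pair of numbers iff re-normalising it does nothing**, and then it codes
`(⟦x.1⟧, ⟦x.2⟧)`. [folklore] -/
theorem eq_renorm_iff (x : List Bool) :
    x = renormFn x ↔ ∃ N k : ℕ, x = boolPair (encodeNat N) (encodeNat k) := by
  rw [renormFn_apply]
  constructor
  · intro h
    exact ⟨_, _, h⟩
  · rintro ⟨N, k, rfl⟩
    simp

/-- Membership in `FACT` of an arbitrary string: it must code a pair `(N, k) ∈ factSet`.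
[cite: AroraBarakCC2009, Example 2.3] -/
theorem mem_FACT_iff (x : List Bool) :
    x ∈ FACT ↔ ∃ N k : ℕ, x = boolPair (encodeNat N) (encodeNat k) ∧ (N, k) ∈ factSet := by
  constructor
  · rintro ⟨⟨N, k⟩, hNk, rfl⟩
    exact ⟨N, k, rfl, hNk⟩
  · rintro ⟨N, k, rfl, hNk⟩
    exact ⟨(N, k), hNk, rfl⟩

/-! ### The verifier -/

/-- The verifier's indicator on `w = ⟨x, y⟩`, `x = ⟨a, b⟩`: `x` is a valid instance code, and
`1 < ⟦y⟧`, `⟦y⟧ ≤ ⟦b⟧`, `⟦a⟧ mod ⟦y⟧ = 0`. [cite: AroraBarakCC2009, Example 2.3 (the certificate is the factor)] -/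
noncomputable def factVerFn : List Bool → List Bool :=
  andFn (andFn (andFn (eqPairFn ∘ fanoutFn fstF (renormFn ∘ fstF))
    (ltFn ∘ fanoutFn (fun _ => [true]) sndF))
    (notFn (ltFn ∘ fanoutFn (sndF ∘ fstF) sndF)))
    (isNilFn ∘ remFn ∘ fanoutFn (fstF ∘ fstF) sndF)

/-- `factVerFn ∈ FP`. [cite: AroraBarakCC2009, Example 2.3] -/
theorem factVerFn_mem_FP : factVerFn ∈ FP :=
  andFn_mem_FP (andFn_mem_FP (andFn_mem_FP
    (comp_mem_FP eqPairFn_mem_FP (fanoutFn_mem_FP fstF_mem_FP (comp_mem_FP renormFn_mem_FP fstF_mem_FP)))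
    (comp_mem_FP ltFn_mem_FP (fanoutFn_mem_FP (const_mem_FP _) sndF_mem_FP)))
    (notFn_mem_FP (comp_mem_FP ltFn_mem_FP (fanoutFn_mem_FP (comp_mem_FP sndF_mem_FP fstF_mem_FP) sndF_mem_FP))))
    (comp_mem_FP isNilFn_mem_FP (comp_mem_FP remFn_mem_FP (fanoutFn_mem_FP (comp_mem_FP fstF_mem_FP fstF_mem_FP) sndF_mem_FP)))

/-- The equality test is one-bit. [folklore] -/
theorem oneBit_eqPairFn : OneBit eqPairFn := fun w => by
  rcases eqPairFn_eq_or w with h | h <;> exact ⟨_, h⟩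

/-- `factVerFn` is one-bit. [folklore] -/
theorem oneBit_factVerFn : OneBit factVerFn :=
  oneBit_andFn (oneBit_andFn (oneBit_andFn (oneBit_eqPairFn.comp _) (oneBit_ltFn.comp _))
    (oneBit_notFn (oneBit_ltFn.comp _))) (oneBit_isNilFn.comp _)

/-- **Value of the verifier on a pair.** [cite: AroraBarakCC2009, Example 2.3] -/
theorem factVerFn_boolPair (x y : List Bool) :
    factVerFn (boolPair x y) = [decide (x = renormFn x ∧ 1 < bitsToNat y ∧
      bitsToNat y ≤ bitsToNat (sndF x) ∧ bitsToNat (fstF x) % bitsToNat y = 0)] := by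
  have h1 : (eqPairFn ∘ fanoutFn fstF (renormFn ∘ fstF)) (boolPair x y) = [decide (x = renormFn x)] := by
    simp [eqPairFn_boolPair]
  have h2 : (ltFn ∘ fanoutFn (fun _ => [true]) sndF) (boolPair x y) = [decide (1 < bitsToNat y)] := by
    simp
  have h3 : (ltFn ∘ fanoutFn (sndF ∘ fstF) sndF) (boolPair x y) = [decide (bitsToNat (sndF x) < bitsToNat y)] := by
    simp
  have h4 : (isNilFn ∘ remFn ∘ fanoutFn (fstF ∘ fstF) sndF) (boolPair x y) =
      [decide (bitsToNat (fstF x) % bitsToNat y = 0)] := by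
    simp only [Function.comp_apply, fanoutFn_apply, fstF_boolPair, sndF_boolPair, remFn_boolPair, isNilFn]
    congr 1
    rw [decide_eq_decide]
    constructor
    · intro h
      simpa using congrArg bitsToNat h
    · intro h
      rw [h]; rfl
  unfold factVerFn
  rw [andFn_apply (andFn_apply (andFn_apply h1 h2) (notFn_apply h3)) h4]
  by_cases h : bitsToNat (sndF x) < bitsToNat y
  · simp [h, Nat.not_le_of_lt h]
  · simp [h, Nat.le_of_not_lt h, Bool.and_assoc]

/-- The verifier's language. [cite: AroraBarakCC2009, Example 2.3] -/
def FactVer : Language Bool := {w | factVerFn w = [true]}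

/-- **`FactVer ∈ P`.** [cite: AroraBarakCC2009, Example 2.3] -/
theorem FactVer_mem_P : FactVer ∈ P :=
  mem_P_of_mem_FP factVerFn_mem_FP _ fun w =>
    ⟨fun h => h, fun h => by
      obtain ⟨b, hb⟩ := oneBit_factVerFn w
      cases b
      · exact hb
      · exact absurd hb h⟩

/-- Membership of a pair in the verifier's language. [cite: AroraBarakCC2009, Example 2.3] -/
theorem boolPair_mem_FactVer (x y : List Bool) :
    boolPair x y ∈ FactVer ↔ x = renormFn x ∧ 1 < bitsToNat y ∧
      bitsToNat y ≤ bitsToNat (sndF x) ∧ bitsToNat (fstF x) % bitsToNat y = 0 := by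
  change factVerFn (boolPair x y) = [true] ↔ _
  rw [factVerFn_boolPair]
  simp

/-! ### `FACT ∈ NP` -/

/-- **pqc.S26, first half** (Arora–Barak 2009, Example 2.3). `FACT ∈ NP`: the divisor `d` (in
binary, `|encodeNat d| ≤ |encodeNat k| ≤ |x|`) is a certificate checked in polynomial time by
`FactVer`. [cite: AroraBarakCC2009, Example 2.3] -/
theorem FACT_mem_NP : FACT ∈ NP := by
  refine ⟨FactVer, FactVer_mem_P, Polynomial.X, fun x => ?_⟩
  rw [mem_FACT_iff]
  constructor
  · rintro ⟨N, k, rfl, d, hd1, hdk, hdN⟩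
    dsimp only at hdk hdN
    refine ⟨encodeNat d, ?_, ?_⟩
    · rw [Polynomial.eval_X, length_boolPair]
      have := length_encodeNat_mono hdk
      omega
    · rw [boolPair_mem_FactVer]
      refine ⟨((eq_renorm_iff _).2 ⟨N, k, rfl⟩), by simpa using hd1, by simpa using hdk, ?_⟩
      simpa using Nat.mod_eq_zero_of_dvd hdN
  · rintro ⟨y, -, hy⟩
    rw [boolPair_mem_FactVer] at hy
    obtain ⟨hx, h1, h2, h3⟩ := hy
    obtain ⟨N, k, rfl⟩ := (eq_renorm_iff x).1 hx
    refine ⟨N, k, rfl, bitsToNat y, h1, by simpa using h2, ?_⟩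
    exact Nat.dvd_of_mod_eq_zero (by simpa using h3)

end Literature.Computability.QuantumComplexity
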